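import Mathlib
import Literature.NumberTheory.Transcendental.GenericPointEmbeddings

/-!
# The walk data for the hard core of the sweep: the polynomial `M(X; T)` and the walk property

For the base point `x'` with `y = e^{x'}`, and `c = 2πi` ALGEBRAIC over `F₁ = ℚ(x', y)`, we build
(`walk_data`) the polynomial `M(X; T) ∈ ℂ[X₁…Xₙ][T]` fed to the iterated-resultant walk
(`Walk.exists_line_subset`): with `μ` the minimal polynomial of `c` over `F₁`, write its
coefficients as quotients of polynomial expressions in `(x', y)` (`exists_mul_aeval_eq`, `F₁` is the
fraction field of `ℚ[x', y]`), clear the common denominator `b` and substitute `Y = y`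
(`eval_aeval_sumElim`), so that `M(x'; T) = b·μ(T)`. With
`O = {z | (z, y) satisfies exactly the ℚ-relations of (x', y)}` we prove: the `T`-leading
coefficient of `M` does not vanish on `O`; `M(x'; c) = 0`; and the WALK PROPERTY — for `z ∈ O`, a
root `θ` of `M(z; ·)` and a point `u = x' + c d ∈ O` (`d ∈ ℤⁿ`), also `z + θ d ∈ O`: realise
`z = ω(x')` by an embedding `ω : F₁^alg ∩ ℂ → ℂ` fixing `y` (`Fields.exists_ringHom_apply_eq`), so
that `M(z; T) = ω(b) · ω(μ)(T)` and `θ = ω(θ₀)` for a root `θ₀` of `μ`; move `c ↦ θ₀` by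
`g ∈ Aut(L/F₁)` (`Fields.exists_algEquiv_apply_eq_of_aeval_minpoly`); then `ω ∘ g` maps
`x' + c d ↦ z + θ d` and transports the `ℚ`-relations.

## References

* [Lang2002] S. Lang, *Algebra*, 3rd ed., GTM 211, Ch. V §2 (extension of embeddings into
  algebraically closed fields, Thm 2.8; conjugates and automorphisms of a normal extension).
-/

noncomputable section

open Polynomial

namespace Literature.NumberTheory.Transcendental.MinpolyWalk

open scoped IntermediateField.algebraAdjoinAdjoin

variable {n : ℕ}

/-- Elements of `ℚ(w)` are quotients of polynomial expressions in `w`. [folklore] -/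
theorem exists_mul_aeval_eq {σ : Type*} (w : σ → ℂ) (z : IntermediateField.adjoin ℚ (Set.range w)) :
    ∃ A B : MvPolynomial σ ℚ, MvPolynomial.aeval w B ≠ 0 ∧
      (z : ℂ) * MvPolynomial.aeval w B = MvPolynomial.aeval w A := by
  obtain ⟨a, b, hb, hab⟩ := IsFractionRing.div_surjective (A := Algebra.adjoin ℚ (Set.range w)) z
  have ha' : (a : ℂ) ∈ (MvPolynomial.aeval w : MvPolynomial σ ℚ →ₐ[ℚ] ℂ).range := by
    rw [MvPolynomial.aeval_range]; exact a.2
  have hb' : (b : ℂ) ∈ (MvPolynomial.aeval w : MvPolynomial σ ℚ →ₐ[ℚ] ℂ).range := by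
    rw [MvPolynomial.aeval_range]; exact b.2
  obtain ⟨A, hA⟩ := ha'
  obtain ⟨B, hB⟩ := hb'
  replace hA : MvPolynomial.aeval w A = (a : ℂ) := hA
  replace hB : MvPolynomial.aeval w B = (b : ℂ) := hB
  have hb0 : (b : ℂ) ≠ 0 := by
    have := nonZeroDivisors.ne_zero hb
    intro h; apply this; exact Subtype.ext h
  refine ⟨A, B, by rwa [hB], ?_⟩
  rw [hA, hB]
  have h' : ((algebraMap (Algebra.adjoin ℚ (Set.range w))
      (IntermediateField.adjoin ℚ (Set.range w)) a :
      IntermediateField.adjoin ℚ (Set.range w)) : ℂ) /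
      ((algebraMap (Algebra.adjoin ℚ (Set.range w)) (IntermediateField.adjoin ℚ (Set.range w)) b :
        IntermediateField.adjoin ℚ (Set.range w)) : ℂ) = (z : ℂ) := by
    rw [← hab]; rfl
  rw [IntermediateField.algebraAdjoinAdjoin.coe_algebraMap,
    IntermediateField.algebraAdjoinAdjoin.coe_algebraMap] at h'
  rw [← h', div_mul_cancel₀ _ hb0]

/-- Substituting `Y = y` and evaluating at `X = z` is evaluating at `(z, y)`. [folklore] -/
theorem eval_aeval_sumElim (y z : Fin n → ℂ) (q : MvPolynomial (Fin n ⊕ Fin n) ℚ) :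
    MvPolynomial.eval z (MvPolynomial.aeval
      (Sum.elim MvPolynomial.X (fun i => MvPolynomial.C (y i)) :
        Fin n ⊕ Fin n → MvPolynomial (Fin n) ℂ) q) =
      MvPolynomial.aeval (Sum.elim z y) q := by
  have h := MvPolynomial.comp_aeval_apply
    ((MvPolynomial.aeval z : MvPolynomial (Fin n) ℂ →ₐ[ℂ] ℂ).restrictScalars ℚ)
    (f := (Sum.elim MvPolynomial.X (fun i => MvPolynomial.C (y i)) :
        Fin n ⊕ Fin n → MvPolynomial (Fin n) ℂ)) q
  simp only [AlgHom.coe_restrictScalars'] at h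
  rw [MvPolynomial.aeval_eq_eval] at h
  rw [h]
  congr 1
  ext j
  rcases j with i | i <;> simp


/-- **The walk data.** For `c` algebraic over `F₁ = ℚ(x', y)` (`c ≠ 0`) there is a polynomial
`M(X; T)` over `ℂ` (obtained from the minimal polynomial `μ` of `c` over `F₁` by clearing
denominators and substituting `Y = y`) such that, with
`O = {z | (z, y) satisfies exactly the ℚ-relations of (x', y)}`:
the `T`-leading coefficient of `M` does not vanish on `O`; `M(x'; c) = 0`; and the WALK PROPERTY:
for `z ∈ O`, a root `θ` of `M(z; ·)`, and `u = x' + c d ∈ O` with `d ∈ ℤⁿ`, also `z + θ d ∈ O`.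
[folklore] -/
theorem walk_data (x' y : Fin n → ℂ) {c : ℂ}
    (hc : IsAlgebraic (IntermediateField.adjoin ℚ (Set.range (Sum.elim x' y))) c) :
    ∃ M : Polynomial (MvPolynomial (Fin n) ℂ),
      (∀ z : Fin n → ℂ, (∀ q : MvPolynomial (Fin n ⊕ Fin n) ℚ,
          MvPolynomial.aeval (Sum.elim z y) q = 0 ↔ MvPolynomial.aeval (Sum.elim x' y) q = 0) →
        MvPolynomial.eval z M.leadingCoeff ≠ 0) ∧
      (M.map (MvPolynomial.eval x')).IsRoot c ∧
      ∀ z : Fin n → ℂ, (∀ q : MvPolynomial (Fin n ⊕ Fin n) ℚ,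
          MvPolynomial.aeval (Sum.elim z y) q = 0 ↔ MvPolynomial.aeval (Sum.elim x' y) q = 0) →
        ∀ θ : ℂ, (M.map (MvPolynomial.eval z)).IsRoot θ →
        ∀ d : Fin n → ℤ, (∀ q : MvPolynomial (Fin n ⊕ Fin n) ℚ,
          MvPolynomial.aeval (Sum.elim (fun i => x' i + c * (d i : ℂ)) y) q = 0 ↔
            MvPolynomial.aeval (Sum.elim x' y) q = 0) →
        ∀ q : MvPolynomial (Fin n ⊕ Fin n) ℚ,
          MvPolynomial.aeval (Sum.elim (fun i => z i + θ * (d i : ℂ)) y) q = 0 ↔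
            MvPolynomial.aeval (Sum.elim x' y) q = 0 := by
  classical
  -- the fields `F₁ = ℚ(x', y) ⊆ L = F₁^alg ∩ ℂ ∋ c`
  set w : Fin n ⊕ Fin n → ℂ := Sum.elim x' y with hw
  set F₁ := IntermediateField.adjoin ℚ (Set.range w) with hF₁
  set L := algebraicClosure F₁ ℂ with hL
  haveI : IsAlgClosed L := IsAlgClosure.isAlgClosed F₁
  have hcL : c ∈ L := mem_algebraicClosure_iff.2 hc
  set cL : L := ⟨c, hcL⟩ with hcLdef
  let wF : Fin n ⊕ Fin n → F₁ := fun j => ⟨w j, Fields.mem_adjoin_range w j⟩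
  let wL : Fin n ⊕ Fin n → L := fun j => algebraMap F₁ L (wF j)
  have hwL : ∀ j, ((wL j : L) : ℂ) = w j := fun j => rfl
  have hwfun : (fun j => ((wL j : L) : ℂ)) = w := funext hwL
  let ιL : L →+* ℂ := algebraMap L ℂ
  have hιL : ∀ t : L, ιL t = (t : ℂ) := fun t => rfl
  have haevalL : ∀ (v : Fin n ⊕ Fin n → L) (q : MvPolynomial (Fin n ⊕ Fin n) ℚ),
      ((MvPolynomial.aeval v q : L) : ℂ) = MvPolynomial.aeval (fun j => (v j : ℂ)) q := by
    intro v q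
    rw [← hιL, ← Fields.aeval_ringHom_comp ιL v q]
    rfl
  -- the minimal polynomial of `c` over `F₁` and a common denominator of its coefficients
  have hint : IsIntegral F₁ cL := Algebra.IsIntegral.isIntegral cL
  set μ : Polynomial F₁ := minpoly F₁ cL with hμ
  have hμ0 : Polynomial.aeval cL μ = 0 := minpoly.aeval F₁ cL
  have hμmonic : μ.Monic := minpoly.monic hint
  set d := μ.natDegree with hd
  have hden := fun j => exists_mul_aeval_eq w (μ.coeff j)
  choose A B hB hAB using hden
  set Bprod : MvPolynomial (Fin n ⊕ Fin n) ℚ := ∏ j ∈ Finset.range (d + 1), B j with hBprod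
  have hb0 : MvPolynomial.aeval w Bprod ≠ 0 := by
    rw [hBprod, map_prod]
    exact Finset.prod_ne_zero_iff.2 fun j _ => hB j
  set At : ℕ → MvPolynomial (Fin n ⊕ Fin n) ℚ :=
    fun j => A j * ∏ j' ∈ (Finset.range (d + 1)).erase j, B j' with hAt
  have hAt_eval : ∀ j ∈ Finset.range (d + 1),
      MvPolynomial.aeval w (At j) = (μ.coeff j : ℂ) * MvPolynomial.aeval w Bprod := by
    intro j hj
    simp only [hAt, map_mul, map_prod]
    rw [← hAB j, hBprod, map_prod, ← Finset.mul_prod_erase _ _ hj]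
    ring
  -- the polynomial `Mq = ∑ At_j T^j` over `ℚ[X, Y]` and `M = Mq(X, y; T)` over `ℂ[X]`
  set Mq : Polynomial (MvPolynomial (Fin n ⊕ Fin n) ℚ) :=
    ∑ j ∈ Finset.range (d + 1), Polynomial.C (At j) * Polynomial.X ^ j with hMq
  have hMq_coeff : ∀ i, Mq.coeff i = if i < d + 1 then At i else 0 := by
    intro i
    simp only [hMq, Polynomial.finsetSum_coeff, Polynomial.coeff_C_mul_X_pow]
    rw [Finset.sum_ite_eq (Finset.range (d + 1)) i At]
    simp [Finset.mem_range]
  let subY : MvPolynomial (Fin n ⊕ Fin n) ℚ →ₐ[ℚ] MvPolynomial (Fin n) ℂ :=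
    MvPolynomial.aeval (Sum.elim MvPolynomial.X (fun i => MvPolynomial.C (y i)))
  have hsubY : ∀ z q, MvPolynomial.eval z (subY q) = MvPolynomial.aeval (Sum.elim z y) q :=
    fun z q => eval_aeval_sumElim y z q
  set M : Polynomial (MvPolynomial (Fin n) ℂ) := Mq.map (subY : _ →+* _) with hM
  have hMz : ∀ z, M.map (MvPolynomial.eval z) =
      Mq.map ((MvPolynomial.aeval (Sum.elim z y) : MvPolynomial (Fin n ⊕ Fin n) ℚ →ₐ[ℚ] ℂ) :
        MvPolynomial (Fin n ⊕ Fin n) ℚ →+* ℂ) := by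
    intro z
    rw [hM, Polynomial.map_map]
    congr 1
    exact RingHom.ext fun q => hsubY z q
  have hM_coeff : ∀ i, M.coeff i = if i < d + 1 then subY (At i) else 0 := by
    intro i
    rw [hM, Polynomial.coeff_map, hMq_coeff]
    split_ifs <;> simp
  -- the top coefficient
  have hb1 : MvPolynomial.aeval w (At d) = MvPolynomial.aeval w Bprod := by
    rw [hAt_eval d (Finset.self_mem_range_succ d)]
    have : μ.coeff d = 1 := hμmonic.coeff_natDegree
    rw [this]; simp
  have htop : subY (At d) ≠ 0 := by
    intro h0
    apply hb0
    rw [← hb1, hw, ← hsubY x', h0, map_zero]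
  have hMdeg : M.natDegree = d := by
    refine Polynomial.natDegree_eq_of_le_of_coeff_ne_zero ?_ ?_
    · rw [Polynomial.natDegree_le_iff_coeff_eq_zero]
      intro i hi
      rw [hM_coeff, if_neg]
      omega
    · rw [hM_coeff, if_pos (Nat.lt_succ_self d)]
      exact htop
  have hMlc : M.leadingCoeff = subY (At d) := by
    rw [Polynomial.leadingCoeff, hMdeg, hM_coeff, if_pos (Nat.lt_succ_self d)]
  refine ⟨M, ?_, ?_, ?_⟩
  · -- (hO) the leading coefficient does not vanish on `O`
    intro z hz h0
    rw [hMlc, hsubY] at h0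
    rw [hz] at h0
    apply hb0
    rw [← hb1, ← h0]
  · -- `M(x'; c) = 0`
    rw [Polynomial.IsRoot.def, hMz, Polynomial.eval_map, hMq, Polynomial.eval₂_finsetSum]
    simp only [Polynomial.eval₂_mul, Polynomial.eval₂_C, Polynomial.eval₂_X_pow, RingHom.coe_coe]
    have h1 : ∀ j ∈ Finset.range (d + 1),
        MvPolynomial.aeval (Sum.elim x' y) (At j) * c ^ j =
          MvPolynomial.aeval w Bprod * ((μ.coeff j : ℂ) * c ^ j) := by
      intro j hj
      rw [← hw, hAt_eval j hj]; ring
    rw [Finset.sum_congr rfl h1, ← Finset.mul_sum]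
    have h2 : ∑ j ∈ Finset.range (d + 1), (μ.coeff j : ℂ) * c ^ j =
        ((Polynomial.aeval cL μ : L) : ℂ) := by
      rw [Polynomial.aeval_eq_sum_range, ← hd]
      rw [← hιL, map_sum]
      refine Finset.sum_congr rfl fun j _ => ?_
      rw [Algebra.smul_def, map_mul, map_pow]
      rfl
    rw [h2, hμ0]
    simp
  · -- the walk property
    intro z hz θ hθ dv hu q
    -- realise `z = ω(x')` by an embedding `ω : L → ℂ` fixing `y`
    obtain ⟨ω, hω⟩ := Fields.exists_ringHom_apply_eq w (Sum.elim z y) hz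
    -- `M(z; T)` is the image under `ω` of `ML = Mq(wL; T) = b_L · μ_L`
    set ML : Polynomial L :=
      Mq.map ((MvPolynomial.aeval wL : MvPolynomial (Fin n ⊕ Fin n) ℚ →ₐ[ℚ] L) :
        MvPolynomial (Fin n ⊕ Fin n) ℚ →+* L) with hML
    have hMLω : ML.map ω = M.map (MvPolynomial.eval z) := by
      rw [hMz, hML, Polynomial.map_map]
      congr 1
      refine RingHom.ext fun r => ?_
      rw [RingHom.comp_apply]
      change ω (MvPolynomial.aeval wL r) = MvPolynomial.aeval (Sum.elim z y) r
      rw [← Fields.aeval_ringHom_comp ω wL r]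
      have hfun : (fun j => ω (wL j)) = Sum.elim z y := funext hω
      rw [hfun]
    set bL : L := MvPolynomial.aeval wL Bprod with hbL
    have hbLc : (bL : ℂ) = MvPolynomial.aeval w Bprod := by
      rw [hbL, haevalL, hwfun]
    have hbL0 : bL ≠ 0 := by
      intro h0; apply hb0; rw [← hbLc, h0]; rfl
    have hMLeq : ML = Polynomial.C bL * μ.map (algebraMap F₁ L) := by
      ext i
      rw [hML, Polynomial.coeff_map, hMq_coeff, Polynomial.coeff_C_mul, Polynomial.coeff_map]
      split_ifs with hi
      · change ((MvPolynomial.aeval wL (At i) : L) : ℂ) =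
          ((bL * algebraMap F₁ L (μ.coeff i) : L) : ℂ)
        rw [haevalL, hwfun, hAt_eval i (Finset.mem_range.2 hi), MulMemClass.coe_mul, hbLc, mul_comm]
        rfl
      · rw [map_zero, Polynomial.coeff_eq_zero_of_natDegree_lt (by omega), map_zero, mul_zero]
    -- `θ = ω θ₀` for a root `θ₀ ∈ L` of `μ`
    have hMz0 : M.map (MvPolynomial.eval z) ≠ 0 := by
      intro h0
      have := congrArg (fun P : Polynomial ℂ => P.coeff d) h0
      simp only [Polynomial.coeff_map, Polynomial.coeff_zero] at this
      rw [hM_coeff, if_pos (Nat.lt_succ_self d), hsubY, hz] at this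
      apply hb0; rw [← hb1, ← this]
    have hθmem : θ ∈ (M.map (MvPolynomial.eval z)).roots := (Polynomial.mem_roots hMz0).2 hθ
    rw [← hMLω, Fields.roots_map_eq ω ML, Multiset.mem_map] at hθmem
    obtain ⟨θ₀, hθ₀, rfl⟩ := hθmem
    have hθ₀μ : Polynomial.aeval θ₀ μ = 0 := by
      rw [hMLeq, Polynomial.roots_C_mul _ hbL0, Polynomial.mem_roots', Polynomial.IsRoot.def,
        Polynomial.eval_map_algebraMap] at hθ₀
      exact hθ₀.2
    -- move `c` to `θ₀` by an automorphism of `L` over `F₁`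
    obtain ⟨g, hg⟩ := Fields.exists_algEquiv_apply_eq_of_aeval_minpoly (F₁ := F₁) hθ₀μ
    set χ : L →+* ℂ := ω.comp g.toAlgHom.toRingHom with hχ
    have hχw : ∀ j, χ (wL j) = Sum.elim z y j := by
      intro j
      rw [hχ, RingHom.comp_apply]
      change ω (g (algebraMap F₁ L (wF j))) = _
      rw [AlgEquiv.commutes]
      exact hω j
    have hχc : χ cL = ω θ₀ := by
      change ω (g cL) = _
      rw [hg]
    have hχd : ∀ i, χ ((dv i : ℤ) : L) = (dv i : ℂ) := fun i => map_intCast χ _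
    have hcoe_int : ∀ m : ℤ, (((m : L)) : ℂ) = (m : ℂ) := fun m => by
      rw [← hιL]; exact map_intCast ιL m
    -- the point `u_L = x'_L + c_L d` over `L` is mapped by `χ = ω ∘ g` to `z + θ d`
    set uL : Fin n → L := fun i => wL (Sum.inl i) + cL * ((dv i : ℤ) : L) with huL
    have huLc : ∀ i, ((uL i : L) : ℂ) = x' i + c * (dv i : ℂ) := by
      intro i
      change ((wL (Sum.inl i) : L) : ℂ) + (cL : ℂ) * (((dv i : ℤ) : L) : ℂ) = _
      rw [hwL, hcoe_int, hw, Sum.elim_inl]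
    have hχu : ∀ i, χ (uL i) = z i + ω θ₀ * (dv i : ℂ) := by
      intro i
      simp only [huL, map_add, map_mul, hχw, Sum.elim_inl, hχc, hχd]
    -- transport of the relations of `u = x' + c d` along `χ`
    have key : MvPolynomial.aeval (Sum.elim (fun i => z i + ω θ₀ * (dv i : ℂ)) y) q =
        χ (MvPolynomial.aeval (Sum.elim uL (fun i => wL (Sum.inr i))) q) := by
      rw [← Fields.aeval_ringHom_comp χ]
      have hfun : (Sum.elim (fun i => z i + ω θ₀ * (dv i : ℂ)) y) =
          fun j => χ (Sum.elim uL (fun i => wL (Sum.inr i)) j) := by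
        funext j
        rcases j with i | i
        · simp only [Sum.elim_inl, hχu]
        · simp only [Sum.elim_inr, hχw]
      rw [hfun]
    have key2 : ((MvPolynomial.aeval (Sum.elim uL (fun i => wL (Sum.inr i))) q : L) : ℂ) =
        MvPolynomial.aeval (Sum.elim (fun i => x' i + c * (dv i : ℂ)) y) q := by
      rw [haevalL]
      have hfun : (fun j => ((Sum.elim uL (fun i => wL (Sum.inr i)) j : L) : ℂ)) =
          Sum.elim (fun i => x' i + c * (dv i : ℂ)) y := by
        funext j
        rcases j with i | i
        · simp only [Sum.elim_inl, huLc]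
        · simp only [Sum.elim_inr, hwL, hw]
      rw [hfun]
    rw [key, map_eq_zero_iff χ χ.injective, ← hu q, ← key2]
    exact (ZeroMemClass.coe_eq_zero).symm

end Literature.NumberTheory.Transcendental.MinpolyWalk

end
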